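import Summits.BirchSwinnertonDyer.BirchSwinnertonDyer.Theorems.GenusKolyvaginAtTwoGenusPrimitiveSupplyAtTwoHeegnerTwinTransposition
import Literature.NumberTheory.EllipticCurves.BinaryQuarticStabilizerTorsion
import Literature.NumberTheory.EllipticCurves.OrdinaryPrimesProofs
import Mathlib.NumberTheory.Padics.Hensel
import Mathlib.NumberTheory.Padics.RingHoms
import HarnessLib

/-!
# Route `GenusKolyvaginAtTwo`, crux `GenusPrimitiveSupplyAtTwo` (stmt-BirchSwinnertonDyer-22136):
# local `2`-torsion at an odd good prime — `#E(ℚ_q)[2] = 1 + #{roots of ψ mod q}` (Hensel bridge)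

Seat `bsd-line-gk2-p5` g6 (cell `bsd-f1-sign2`), SUPPLY lineage (g0 `…TwinSupply*.lean`, g2 `…HeegnerTwin*.lean`).
Summit-side THEOREM-ONLY file (no definition, no named fact, no `sorry`), `--supports stmt-BirchSwinnertonDyer-22136`.

WHY. The cell's DEF-currency for a Heegner field `K` of a habitat curve `E` (minimal model `W`) counts, at each prime
`q ∣ d_K`, the dimension of `Ẽ(𝔽_q)[2]`, i.e. the number of roots mod `q` of the `2`-division cubic
`ψ = 4x³ + b₂x² + 2b₄x + b₆` of the minimal model («transposition prime» = exactly one root, «silent prime» = no root;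
g2 files `…HeegnerTwinParity`, `…HeegnerTwinTransposition`). The printed `2`-Selmer twist comparison the line consumes —
Mazur–Rubin 2010 Prop. 3.3 / Cor. 3.4, tree named facts `MazurRubin2010.prop33_rat`, `cor34i_singleton_rat`,
`cor34ii_rat` — is typed in the LOCAL currency `#E(ℚ_q)[2]`, as `Nat.card {Q : (W.baseChange ℚ_[q]).toAffine.Point // 2 • Q = 0}`.
THIS FILE is the bridge between the two currencies at an odd prime `q ∤ Δ_min(W)` (so `q` is a prime of good reduction and
`ψ mod q` is separable):

* §1–§3 (any `f ∈ ℤ[X]`): reduction of `ℤ_q`-roots mod `q`; HENSEL LIFT of a simple root of `f mod q` to a root in `ℤ_q`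
  (Mathlib `hensels_lemma`); two `ℤ_q`-roots with the same SIMPLE reduction coincide; hence for `f mod q` separable on its
  roots, reduction is a BIJECTION `{roots of f in ℤ_q} → {roots of f mod q}` (`ncard_setOf_aeval_eq_zero_eq`).
* §4: a `ℚ_q`-root of the cubic `4x³ + b₂x² + 2b₄x + b₆` (`q` odd, `bᵢ ∈ ℤ`) is `q`-integral.
* §5: **`#E(ℚ_q)[2] = #{x̄ ∈ 𝔽_q : ψ(x̄) = 0} + 1`** for `W/ℚ` globally minimal elliptic, `q` odd, `q ∤ Δ_min(W)`
  (`natCard_twoTorsion_padic_eq`); consequences in the Mazur–Rubin currency: exactly one root mod `q` ⟹ `#E(ℚ_q)[2] = 2`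
  (a `T`-prime of Prop. 3.3), no root mod `q` ⟹ `E(ℚ_q)[2] = 0` (a prime outside `T`), and `(Δ_min/q) = −1` ⟹
  `#E(ℚ_q)[2] = 2` (`natCard_twoTorsion_padic_eq_two_of_jacobiSym_eq_neg_one`, via g2's Stickelberger criterion).

References: [SilvermanAEC2009] III.1 (`ψ₂`, `disc ψ = 16Δ`), VII.1–VII.3 (reduction, `2`-torsion injects for `q ∤ 2Δ`);
K. Conrad / Mathlib `hensels_lemma` [folklore]; [MazurRubin2010] Lemma 2.2 (i) (`dim H¹_f(ℚ_q, E[2]) = dim E(ℚ_q)[2]`).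
No item is closed by this file; BSD is not proved by any of this.
-/

set_option linter.dupNamespace false -- tree convention: `Summit.BirchSwinnertonDyer.BirchSwinnertonDyer.Theorems` (summit = sub-problem)
set_option autoImplicit false

noncomputable section

open scoped Classical

open Polynomial

namespace Summit.BirchSwinnertonDyer.BirchSwinnertonDyer.Theorems.GenusKolyTwin

section Hensel

variable {q : ℕ} [Fact q.Prime]

/-! ## §1. Reduction of `ℤ_q`-values of an integral polynomial mod `q` -/

/-- Reduction mod `q` commutes with evaluation: `f(z) mod q = (f mod q)(z mod q)` for `f ∈ ℤ[X]`, `z ∈ ℤ_q`. [folklore] -/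
theorem toZMod_aeval (f : ℤ[X]) (z : ℤ_[q]) :
    PadicInt.toZMod (aeval z f) = (f.map (Int.castRingHom (ZMod q))).eval (PadicInt.toZMod z) := by
  rw [aeval_def, hom_eval₂, eval_map]
  congr 1
  exact RingHom.ext_int _ _

/-- `‖x‖ < 1` in `ℤ_q` iff `x ≡ 0 (mod q)`. [folklore] -/
theorem norm_lt_one_iff_toZMod_eq_zero (x : ℤ_[q]) : ‖x‖ < 1 ↔ PadicInt.toZMod x = 0 := by
  rw [← RingHom.mem_ker, PadicInt.ker_toZMod, IsLocalRing.mem_maximalIdeal, PadicInt.mem_nonunits]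

/-- `‖x‖ = 1` in `ℤ_q` iff `x ≢ 0 (mod q)`. [folklore] -/
theorem norm_eq_one_iff_toZMod_ne_zero (x : ℤ_[q]) : ‖x‖ = 1 ↔ PadicInt.toZMod x ≠ 0 := by
  rw [Ne, ← norm_lt_one_iff_toZMod_eq_zero, not_lt]
  exact ⟨fun h => h.ge, fun h => le_antisymm (PadicInt.norm_le_one x) h⟩

/-- Two `q`-adic integers have the same reduction iff their difference has norm `< 1`. [folklore] -/
theorem toZMod_eq_toZMod_iff_norm_sub_lt_one (x y : ℤ_[q]) :
    PadicInt.toZMod x = PadicInt.toZMod y ↔ ‖x - y‖ < 1 := by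
  rw [norm_lt_one_iff_toZMod_eq_zero, map_sub, sub_eq_zero]

/-- A `ℤ_q`-root of `f` reduces to a root of `f mod q`. [folklore] -/
theorem isRoot_map_toZMod_of_aeval_eq_zero (f : ℤ[X]) {z : ℤ_[q]} (hz : aeval z f = 0) :
    (f.map (Int.castRingHom (ZMod q))).IsRoot (PadicInt.toZMod z) := by
  rw [IsRoot.def, ← toZMod_aeval, hz, map_zero]

/-- Every residue class mod `q` is the reduction of a `q`-adic integer. [folklore] -/
theorem exists_toZMod_eq (x : ZMod q) : ∃ z : ℤ_[q], PadicInt.toZMod z = x :=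
  ⟨(x.val : ℤ_[q]), by rw [map_natCast, ZMod.natCast_zmod_val]⟩

/-! ## §2. Hensel lift of a simple root -/

/-- **Hensel lift.** A SIMPLE root `x̄` of `f mod q` (`f ∈ ℤ[X]`) lifts to a root `z ∈ ℤ_q` of `f` with `z mod q = x̄`
(Mathlib `hensels_lemma` with `‖f(a)‖ < 1 = ‖f′(a)‖²` at any lift `a` of `x̄`). [folklore] -/
theorem exists_aeval_eq_zero_of_isRoot (f : ℤ[X]) {x : ZMod q}
    (hx : (f.map (Int.castRingHom (ZMod q))).IsRoot x)
    (hx' : ¬ (f.map (Int.castRingHom (ZMod q))).derivative.IsRoot x) :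
    ∃ z : ℤ_[q], aeval z f = 0 ∧ PadicInt.toZMod z = x := by
  obtain ⟨a, rfl⟩ := exists_toZMod_eq x
  have h1 : ‖aeval a f‖ < 1 := by
    rw [norm_lt_one_iff_toZMod_eq_zero, toZMod_aeval]
    exact hx
  have h2 : ‖aeval a (derivative f)‖ = 1 := by
    rw [norm_eq_one_iff_toZMod_ne_zero, toZMod_aeval, ← derivative_map]
    exact hx'
  have hnorm : ‖aeval a f‖ < ‖aeval a (derivative f)‖ ^ 2 := by rw [h2, one_pow]; exact h1
  obtain ⟨z, hz, hza, -, -⟩ := hensels_lemma hnorm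
  refine ⟨z, hz, ?_⟩
  rw [toZMod_eq_toZMod_iff_norm_sub_lt_one, ← h2]
  exact hza

/-! ## §3. Uniqueness of the lift and the root bijection -/

/-- Two `ℤ_q`-roots of `f` with the same reduction, which is a SIMPLE root of `f mod q`, are equal (uniqueness clause of
`hensels_lemma` at `a = z₁`). [folklore] -/
theorem eq_of_aeval_eq_zero_of_toZMod_eq (f : ℤ[X]) {z₁ z₂ : ℤ_[q]} (h₁ : aeval z₁ f = 0) (h₂ : aeval z₂ f = 0)
    (h : PadicInt.toZMod z₁ = PadicInt.toZMod z₂)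
    (hs : ¬ (f.map (Int.castRingHom (ZMod q))).derivative.IsRoot (PadicInt.toZMod z₁)) : z₁ = z₂ := by
  have hd : ‖aeval z₁ (derivative f)‖ = 1 := by
    rw [norm_eq_one_iff_toZMod_ne_zero, toZMod_aeval, ← derivative_map]
    exact hs
  have hnorm : ‖aeval z₁ f‖ < ‖aeval z₁ (derivative f)‖ ^ 2 := by
    rw [h₁, norm_zero, hd, one_pow]; exact one_pos
  obtain ⟨z, -, -, -, huniq⟩ := hensels_lemma hnorm
  have e₁ : z₁ = z := huniq z₁ h₁ (by rw [sub_self, norm_zero, hd]; exact one_pos)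
  have e₂ : z₂ = z := huniq z₂ h₂ (by rw [hd, ← toZMod_eq_toZMod_iff_norm_sub_lt_one]; exact h.symm)
  rw [e₁, e₂]

/-- **Root bijection.** If every root of `f mod q` is simple, reduction mod `q` is a bijection from the `ℤ_q`-roots of `f`
onto the roots of `f mod q`; in particular the two root sets have the same size. [folklore] -/
theorem ncard_setOf_aeval_eq_zero_eq (f : ℤ[X])
    (hsep : ∀ x : ZMod q, (f.map (Int.castRingHom (ZMod q))).IsRoot x →
      ¬ (f.map (Int.castRingHom (ZMod q))).derivative.IsRoot x) :
    {z : ℤ_[q] | aeval z f = 0}.ncard = {x : ZMod q | (f.map (Int.castRingHom (ZMod q))).IsRoot x}.ncard := by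
  refine Set.ncard_congr (fun z _ => PadicInt.toZMod z) (fun z hz => isRoot_map_toZMod_of_aeval_eq_zero f hz)
    (fun z₁ z₂ h₁ h₂ h => eq_of_aeval_eq_zero_of_toZMod_eq f h₁ h₂ h
      (hsep _ (isRoot_map_toZMod_of_aeval_eq_zero f h₁))) (fun x hx => ?_)
  obtain ⟨z, hz, hzx⟩ := exists_aeval_eq_zero_of_isRoot f hx (hsep x hx)
  exact ⟨z, hz, hzx⟩

/-! ## §4. `ℚ_q`-roots of the `2`-division cubic are `q`-integral (`q` odd) -/

/-- For `q` odd and `b₂, b₄, b₆ ∈ ℤ`, every `ℚ_q`-root of `4x³ + b₂x² + 2b₄x + b₆` lies in `ℤ_q` (the leading coefficient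
`4` is a `q`-adic unit; ultrametric inequality). [folklore] -/
theorem norm_le_one_of_cubic_root (hq2 : q ≠ 2) (b₂ b₄ b₆ : ℤ) {x : ℚ_[q]}
    (hx : 4 * x ^ 3 + (b₂ : ℚ_[q]) * x ^ 2 + 2 * (b₄ : ℚ_[q]) * x + (b₆ : ℚ_[q]) = 0) : ‖x‖ ≤ 1 := by
  by_contra hlt
  rw [not_le] at hlt
  have h4 : ‖(4 : ℚ_[q])‖ = 1 := by
    have hcop : q.Coprime 4 := by
      rw [Nat.Prime.coprime_iff_not_dvd Fact.out]
      intro h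
      have h22 : q ∣ 2 ^ 2 := by simpa using h
      exact hq2 ((Nat.prime_dvd_prime_iff_eq Fact.out Nat.prime_two).mp (Nat.Prime.dvd_of_dvd_pow Fact.out h22))
    have := (Padic.norm_natCast_eq_one_iff (p := q) (n := 4)).mpr hcop
    simpa using this
  have hint : ∀ z : ℤ, ‖(z : ℚ_[q])‖ ≤ 1 := fun z => Padic.norm_int_le_one z
  have hx1 : 1 ≤ ‖x‖ := hlt.le
  -- `‖4x³‖ = ‖x‖³`
  have hlead : ‖4 * x ^ 3‖ = ‖x‖ ^ 3 := by rw [norm_mul, norm_pow, h4, one_mul]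
  -- the lower terms have norm `≤ ‖x‖²`
  have h₂ : ‖(b₂ : ℚ_[q]) * x ^ 2‖ ≤ ‖x‖ ^ 2 := by
    rw [norm_mul, norm_pow]
    exact mul_le_of_le_one_left (pow_nonneg (norm_nonneg _) _) (hint b₂)
  have h₄ : ‖2 * (b₄ : ℚ_[q]) * x‖ ≤ ‖x‖ ^ 2 := by
    rw [norm_mul, norm_mul]
    have h2le : ‖(2 : ℚ_[q])‖ ≤ 1 := by simpa using hint 2
    calc ‖(2 : ℚ_[q])‖ * ‖(b₄ : ℚ_[q])‖ * ‖x‖ ≤ 1 * 1 * ‖x‖ := by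
          gcongr
          exact hint b₄
      _ = ‖x‖ ^ 1 := by ring
      _ ≤ ‖x‖ ^ 2 := pow_le_pow_right₀ hx1 (by norm_num)
  have h₆ : ‖(b₆ : ℚ_[q])‖ ≤ ‖x‖ ^ 2 := le_trans (hint b₆) (one_le_pow₀ hx1)
  have hsum : ‖(b₂ : ℚ_[q]) * x ^ 2 + 2 * (b₄ : ℚ_[q]) * x + (b₆ : ℚ_[q])‖ ≤ ‖x‖ ^ 2 :=
    le_trans (Padic.nonarchimedean _ _) (max_le (le_trans (Padic.nonarchimedean _ _) (max_le h₂ h₄)) h₆)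
  have heq : 4 * x ^ 3 = -((b₂ : ℚ_[q]) * x ^ 2 + 2 * (b₄ : ℚ_[q]) * x + (b₆ : ℚ_[q])) := by
    linear_combination hx
  have h32 : ‖x‖ ^ 3 ≤ ‖x‖ ^ 2 := by
    rw [← hlead, heq, norm_neg]; exact hsum
  have hlt3 : ‖x‖ ^ 2 < ‖x‖ ^ 3 := pow_lt_pow_right₀ hlt (by norm_num)
  exact absurd h32 (not_le.mpr hlt3)

end Hensel

/-! ## §5. `#E(ℚ_q)[2] = 1 + #{roots of ψ mod q}` for the minimal model at an odd good prime -/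

section Weierstrass

open WeierstrassCurve Literature.NumberTheory.EllipticCurves

variable (W : WeierstrassCurve ℚ) [W.IsElliptic] [W.IsGloballyMinimal] {q : ℕ} [Fact q.Prime]

omit [W.IsElliptic] in
/-- Evaluation of (any base change of) the `2`-division cubic of the integral minimal model:
`ψ(x) = 4x³ + b₂x² + 2b₄x + b₆`. [folklore] -/
theorem eval_map_twoTorsionPolynomial_integralModelInt {S : Type*} [CommRing S] (φ : ℤ →+* S) (x : S) :
    ((integralModelInt W).twoTorsionPolynomial.toPoly.map φ).eval x =
      4 * x ^ 3 + φ (integralModelInt W).b₂ * x ^ 2 + 2 * φ (integralModelInt W).b₄ * x + φ (integralModelInt W).b₆ := by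
  simp only [WeierstrassCurve.twoTorsionPolynomial, Cubic.toPoly, eval_map, eval₂_add, eval₂_mul, eval₂_C,
    eval₂_X_pow, eval₂_X, map_mul]
  simp only [map_ofNat]

omit [W.IsElliptic] in
/-- Base change of the minimal model to `ℚ_q` is the base change of its integral model along `ℤ → ℚ_q`. [folklore] -/
theorem baseChange_padic_eq_map_integralModelInt :
    W.baseChange ℚ_[q] = (integralModelInt W).map (Int.castRingHom ℚ_[q]) := by
  conv_lhs => rw [← map_integralModelInt W]
  rw [baseChange, WeierstrassCurve.map_map]
  congr 1

omit [W.IsElliptic] in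
/-- The roots of the `2`-division cubic of `W/ℚ_q` are the `ℚ_q`-roots of `4x³ + b₂x² + 2b₄x + b₆`
(coefficients of the integral minimal model). [folklore] -/
theorem isRoot_twoTorsionPolynomial_baseChange_padic_iff (x : ℚ_[q]) :
    (W.baseChange ℚ_[q]).twoTorsionPolynomial.toPoly.IsRoot x ↔
      4 * x ^ 3 + ((integralModelInt W).b₂ : ℚ_[q]) * x ^ 2 + 2 * ((integralModelInt W).b₄ : ℚ_[q]) * x +
        ((integralModelInt W).b₆ : ℚ_[q]) = 0 := by
  rw [baseChange_padic_eq_map_integralModelInt W, WeierstrassCurve.map_twoTorsionPolynomial, Cubic.map_toPoly,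
    IsRoot.def, eval_map_twoTorsionPolynomial_integralModelInt, eq_intCast, eq_intCast, eq_intCast]

omit [W.IsElliptic] in
/-- The `ℤ_q`-roots of the integral `2`-division cubic, read through `aeval` and in `ℚ_q`. [folklore] -/
theorem aeval_twoTorsionPolynomial_integralModelInt_eq_zero_iff (z : ℤ_[q]) :
    aeval z (integralModelInt W).twoTorsionPolynomial.toPoly = 0 ↔
      4 * (z : ℚ_[q]) ^ 3 + ((integralModelInt W).b₂ : ℚ_[q]) * (z : ℚ_[q]) ^ 2 +
        2 * ((integralModelInt W).b₄ : ℚ_[q]) * (z : ℚ_[q]) + ((integralModelInt W).b₆ : ℚ_[q]) = 0 := by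
  rw [← eval_map_algebraMap, eval_map_twoTorsionPolynomial_integralModelInt, algebraMap_int_eq, eq_intCast,
    eq_intCast, eq_intCast, ← PadicInt.coe_eq_zero]
  push_cast
  exact Iff.rfl

omit [W.IsElliptic] in
/-- The roots mod `q` of the integral `2`-division cubic, in the explicit currency of
`…HeegnerTwinTransposition` (`4x³ + b₂x² + 2b₄x + b₆ = 0` in `ZMod q`). [folklore] -/
theorem isRoot_twoTorsionPolynomial_map_zmod_iff (x : ZMod q) :
    ((integralModelInt W).twoTorsionPolynomial.toPoly.map (Int.castRingHom (ZMod q))).IsRoot x ↔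
      4 * x ^ 3 + ((integralModelInt W).b₂ : ZMod q) * x ^ 2 + 2 * ((integralModelInt W).b₄ : ZMod q) * x +
        ((integralModelInt W).b₆ : ZMod q) = 0 := by
  rw [IsRoot.def, eval_map_twoTorsionPolynomial_integralModelInt, eq_intCast, eq_intCast, eq_intCast]

omit [W.IsElliptic] in
/-- For `q` odd with `q ∤ Δ_min(W)`, every root of `ψ mod q` is simple (`disc ψ = 16 Δ_min ≢ 0`). [cite: SilvermanAEC2009, III.1 (ψ₂, Δ)] -/
theorem not_isRoot_derivative_twoTorsionPolynomial_zmod (hq2 : q ≠ 2) (hqΔ : ¬ (q : ℤ) ∣ minimalDiscriminantInt W)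
    (x : ZMod q) (hx : ((integralModelInt W).twoTorsionPolynomial.toPoly.map (Int.castRingHom (ZMod q))).IsRoot x) :
    ¬ ((integralModelInt W).twoTorsionPolynomial.toPoly.map (Int.castRingHom (ZMod q))).derivative.IsRoot x := by
  set M : WeierstrassCurve (ZMod q) := (integralModelInt W).map (Int.castRingHom (ZMod q)) with hM
  have hmap : (integralModelInt W).twoTorsionPolynomial.toPoly.map (Int.castRingHom (ZMod q)) =
      M.twoTorsionPolynomial.toPoly := by
    rw [hM, WeierstrassCurve.map_twoTorsionPolynomial, Cubic.map_toPoly]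
  have h2 : (2 : ZMod q) ≠ 0 := by
    have : ((2 : ℕ) : ZMod q) ≠ 0 := by
      rw [Ne, ZMod.natCast_eq_zero_iff]
      intro h
      exact hq2 ((Nat.prime_dvd_prime_iff_eq (Fact.out) Nat.prime_two).mp h)
    exact_mod_cast this
  have hΔ0 : M.Δ ≠ 0 := by
    rw [hM, WeierstrassCurve.map_Δ, Ne, eq_intCast, ZMod.intCast_zmod_eq_zero_iff_dvd]
    exact hqΔ
  have h16 : (16 : ZMod q) ≠ 0 := by
    have : (16 : ZMod q) = 2 ^ 4 := by norm_num
    rw [this]; exact pow_ne_zero _ h2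
  have hdisc0 : M.twoTorsionPolynomial.discr ≠ 0 := by
    rw [WeierstrassCurve.twoTorsionPolynomial_discr]; exact mul_ne_zero h16 hΔ0
  have ha : M.twoTorsionPolynomial.a ≠ 0 := by
    show (4 : ZMod q) ≠ 0
    have : (4 : ZMod q) = 2 ^ 2 := by norm_num
    rw [this]; exact pow_ne_zero _ h2
  rw [hmap] at hx ⊢
  rw [IsRoot.def]
  exact eval_derivative_ne_zero_of_discr_ne_zero M.twoTorsionPolynomial ha hdisc0 hx

omit [W.IsElliptic] in
/-- **`#{x ∈ ℚ_q : ψ(x) = 0} = #{x̄ ∈ 𝔽_q : ψ(x̄) = 0}`** for the `2`-division cubic of the minimal model at an odd prime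
`q ∤ Δ_min(W)`: `ℚ_q`-roots are integral (§4), reduce to roots mod `q`, and reduction is a bijection onto the (simple)
roots mod `q` by Hensel (§2–§3). [cite: SilvermanAEC2009, VII.3 Prop. 3.1(b) (reduction is injective on torsion prime to q)] -/
theorem ncard_roots_twoTorsionPolynomial_padic_eq_zmod (hq2 : q ≠ 2) (hqΔ : ¬ (q : ℤ) ∣ minimalDiscriminantInt W) :
    {x : ℚ_[q] | (W.baseChange ℚ_[q]).twoTorsionPolynomial.toPoly.IsRoot x}.ncard =
      {x : ZMod q | 4 * x ^ 3 + ((integralModelInt W).b₂ : ZMod q) * x ^ 2 +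
        2 * ((integralModelInt W).b₄ : ZMod q) * x + ((integralModelInt W).b₆ : ZMod q) = 0}.ncard := by
  set f : ℤ[X] := (integralModelInt W).twoTorsionPolynomial.toPoly with hf
  -- Step 1: `ℚ_q`-roots ↔ `ℤ_q`-roots (integrality)
  have step1 : {x : ℚ_[q] | (W.baseChange ℚ_[q]).twoTorsionPolynomial.toPoly.IsRoot x}.ncard =
      {z : ℤ_[q] | aeval z f = 0}.ncard := by
    symm
    refine Set.ncard_congr (fun z _ => (z : ℚ_[q])) (fun z hz => ?_) (fun z₁ z₂ _ _ h => PadicInt.ext h)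
      (fun x hx => ?_)
    · rw [Set.mem_setOf_eq, isRoot_twoTorsionPolynomial_baseChange_padic_iff]
      exact (aeval_twoTorsionPolynomial_integralModelInt_eq_zero_iff W z).mp hz
    · rw [Set.mem_setOf_eq, isRoot_twoTorsionPolynomial_baseChange_padic_iff] at hx
      refine ⟨⟨x, norm_le_one_of_cubic_root hq2 _ _ _ hx⟩, ?_, rfl⟩
      exact (aeval_twoTorsionPolynomial_integralModelInt_eq_zero_iff W _).mpr hx
  -- Step 2: `ℤ_q`-roots ↔ roots mod `q` (Hensel)
  have step2 := ncard_setOf_aeval_eq_zero_eq f (not_isRoot_derivative_twoTorsionPolynomial_zmod W hq2 hqΔ)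
  rw [step1, step2]
  congr 1
  ext x
  exact isRoot_twoTorsionPolynomial_map_zmod_iff W x

/-- **`#E(ℚ_q)[2] = #{x̄ ∈ 𝔽_q : ψ(x̄) = 0} + 1`** (`W/ℚ` globally minimal elliptic, `q` odd, `q ∤ Δ_min(W)`), in the currency
`Nat.card {Q : (W.baseChange ℚ_[q]).toAffine.Point // 2 • Q = 0}` of the tree's Mazur–Rubin 2010 named facts.
[cite: SilvermanAEC2009, VII.3 Prop. 3.1(b)] [cite: MazurRubin2010, Lemma 2.2 (i)] -/
theorem natCard_twoTorsion_padic_eq (hq2 : q ≠ 2) (hqΔ : ¬ (q : ℤ) ∣ minimalDiscriminantInt W) :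
    Nat.card {Q : (W.baseChange ℚ_[q]).toAffine.Point // 2 • Q = 0} =
      {x : ZMod q | 4 * x ^ 3 + ((integralModelInt W).b₂ : ZMod q) * x ^ 2 +
        2 * ((integralModelInt W).b₄ : ZMod q) * x + ((integralModelInt W).b₆ : ZMod q) = 0}.ncard + 1 := by
  have h2 : (2 : ℚ_[q]) ≠ 0 := two_ne_zero
  have hcard : Nat.card {Q : (W.baseChange ℚ_[q]).toAffine.Point // 2 • Q = 0} =
      Nat.card (AddSubgroup.torsionBy (W.baseChange ℚ_[q]).toAffine.Point (2 : ℤ)) := by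
    refine Nat.card_congr (Equiv.subtypeEquivRight fun Q => ?_)
    rw [Submodule.mem_toAddSubgroup, Submodule.mem_torsionBy_iff, two_zsmul, two_nsmul]
  rw [hcard, WeierstrassCurve.natCard_torsionBy_two_eq _ h2, ncard_roots_twoTorsionPolynomial_padic_eq_zmod W hq2 hqΔ]

/-- **Transposition prime ⟹ `#E(ℚ_q)[2] = 2`.** If `ψ` has EXACTLY ONE root mod `q` (`q` odd, `q ∤ Δ_min(W)`), then
`#E(ℚ_q)[2] = 2` — `q` is a `T`-prime in the sense of `MazurRubin2010.prop33_rat` / `cor34i_singleton_rat`.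
[cite: MazurRubin2010, Lemma 2.2 (i) and Prop. 3.3] -/
theorem natCard_twoTorsion_padic_eq_two_of_existsUnique (hq2 : q ≠ 2) (hqΔ : ¬ (q : ℤ) ∣ minimalDiscriminantInt W)
    (h : ∃! x : ZMod q, 4 * x ^ 3 + ((integralModelInt W).b₂ : ZMod q) * x ^ 2 +
      2 * ((integralModelInt W).b₄ : ZMod q) * x + ((integralModelInt W).b₆ : ZMod q) = 0) :
    Nat.card {Q : (W.baseChange ℚ_[q]).toAffine.Point // 2 • Q = 0} = 2 := by
  rw [natCard_twoTorsion_padic_eq W hq2 hqΔ]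
  obtain ⟨x, hx, huniq⟩ := h
  have : {x : ZMod q | 4 * x ^ 3 + ((integralModelInt W).b₂ : ZMod q) * x ^ 2 +
      2 * ((integralModelInt W).b₄ : ZMod q) * x + ((integralModelInt W).b₆ : ZMod q) = 0} = {x} := by
    ext y
    exact ⟨fun hy => huniq y hy, fun hy => by rw [Set.mem_singleton_iff.mp hy]; exact hx⟩
  rw [this, Set.ncard_singleton]

/-- **Silent prime ⟹ `E(ℚ_q)[2] = 0`.** If `ψ` has NO root mod `q` (`q` odd, `q ∤ Δ_min(W)`), then `E(ℚ_q)` has no point of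
order `2` — `q` lies outside `T` in the sense of `MazurRubin2010.prop33_rat` (Cor. 3.4 (ii) clause).
[cite: MazurRubin2010, Lemma 2.2 (i) and Cor. 3.4 (ii)] -/
theorem twoTorsion_padic_eq_zero_of_forall_ne (hq2 : q ≠ 2) (hqΔ : ¬ (q : ℤ) ∣ minimalDiscriminantInt W)
    (h : ∀ x : ZMod q, 4 * x ^ 3 + ((integralModelInt W).b₂ : ZMod q) * x ^ 2 +
      2 * ((integralModelInt W).b₄ : ZMod q) * x + ((integralModelInt W).b₆ : ZMod q) ≠ 0) :
    ∀ Q : (W.baseChange ℚ_[q]).toAffine.Point, 2 • Q = 0 → Q = 0 := by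
  have hcard := natCard_twoTorsion_padic_eq W hq2 hqΔ
  have hempty : {x : ZMod q | 4 * x ^ 3 + ((integralModelInt W).b₂ : ZMod q) * x ^ 2 +
      2 * ((integralModelInt W).b₄ : ZMod q) * x + ((integralModelInt W).b₆ : ZMod q) = 0} = ∅ :=
    Set.eq_empty_of_forall_notMem fun x hx => h x hx
  rw [hempty, Set.ncard_empty, zero_add] at hcard
  intro Q hQ
  have h0 : (⟨0, by simp⟩ : {Q : (W.baseChange ℚ_[q]).toAffine.Point // 2 • Q = 0}) = ⟨Q, hQ⟩ := by
    haveI : Finite {Q : (W.baseChange ℚ_[q]).toAffine.Point // 2 • Q = 0} := Nat.finite_of_card_ne_zero (by rw [hcard]; norm_num)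
    exact (Nat.card_eq_one_iff_unique.mp hcard).1.elim _ _
  exact (congrArg Subtype.val h0).symm

/-- **`(Δ_min / q) = −1` ⟹ `#E(ℚ_q)[2] = 2`**: at an odd prime `q ∤ Δ_min(W)` where the minimal discriminant is a quadratic
non-residue, the Frobenius is a transposition on `E[2] ∖ 0` (Stickelberger, `…HeegnerTwinTransposition`), so `E(ℚ_q)[2] ≅ ℤ/2`.
[cite: MazurRubin2010, Lemma 2.2 (i)] [cite: SilvermanAEC2009, III.1] -/
theorem natCard_twoTorsion_padic_eq_two_of_jacobiSym_eq_neg_one (hq2 : q ≠ 2)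
    (hqΔ : ¬ (q : ℤ) ∣ minimalDiscriminantInt W) (hJ : jacobiSym (minimalDiscriminantInt W) q = -1) :
    Nat.card {Q : (W.baseChange ℚ_[q]).toAffine.Point // 2 • Q = 0} = 2 :=
  natCard_twoTorsion_padic_eq_two_of_existsUnique W hq2 hqΔ
    ((existsUnique_zmod_root_twoTorsion_iff_jacobiSym_eq_neg_one W hq2 hqΔ).mpr hJ)

end Weierstrass

end Summit.BirchSwinnertonDyer.BirchSwinnertonDyer.Theorems.GenusKolyTwin
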